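import Summits.QuantumAdvantage.QuantumAdvantage.Theorems.SosSandwichTransferPBQueryMagnitude
import Literature.Computability.Complexity.BoolEncodings
import HarnessLib

/-!
# Route `SosSandwich`, crux `TransferPB` (stmt-QuantumAdvantage-15238): definitions of the machine half of stub `stub_pbOracleSimulation`

`Defs` file (D-0016 convention; objects the line `birth` posits, no theorem proved here). After the reduction stack
`Theorems/SosSandwichTransferPB{MachineReduction,…,QueryMagnitude}.lean` the stub follows from the hypothesis `hmach`
of `SimTreePB.stub_pbOracleSimulation_of_bbbvMachines`: one promise problem in `PromiseBQP` plus one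
polynomial-time transcript machine realising an advisor with BBBV-magnitude pick/refusal clauses. This file FIXES
the promise problem and the advisor a machine derives from an answer function `g`, so that the two remaining
obligations — (Q) `nodeProblem F r c k ∈ PromiseBQP` and (M) a transcript machine computing the threshold bit of
`advTree (derivedAdvisor F x g) (machineBudget F x r c k) []` with the combined oracle `A ⊕ g` — can be
worked independently (the split theorem is `Theorems/SosSandwichTransferPBMachineSplit.lean`).

* `bbbvMag F x ρ s` — the averaged BBBV magnitude `m_s(ρ) = E_y[4T·W_{σ(s)}(oracleOf (y ◁ ρ))]` of the relevant
  bit `s` (verbatim the quantity in the clauses of `stub_pbOracleSimulation_of_bbbvMachines`);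
  `blockMag F x ρ u` — its sum over the bits whose string has prefix `u`; `nodeMean F x ρ` — `E[p_x|_ρ]`;
* `pbThreshold F x r c k` — the influence threshold `w`; `machineBudget F x r c k` — the budget `D`;
* `encPath`, `encBlock`, `encSingle`, `encMean` — self-delimiting instance encodings (`boolPair`): a path is the
  list of (oracle STRING, bit) pairs, a block is a prefix string, tags `00`/`01`/`1` separate the three kinds;
* `nodeProblem F r c k : PromiseProblem` — BLOCK (`M_u(ρ) ≥ w` vs `≤ w/2`), SINGLE (`m_s(ρ) ≥ w` vs `≤ w/2`),
  MEAN (`E ≥ j/40` vs `≤ (j−1)/40`) instances;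
* `derivedAdvisor F x r c k g` — pick the least FREE bit all of whose prefix-block tests and whose single test
  `g` answers `true` (what heavy-prefix descent finds); leaf value `#{j ≤ 40 : MEAN answered true}/40`.

Sources: S. Aaronson, A. Ambainis, Theory Comput. 10 (2014), proof of Thm. 23 (p. 14); C. H. Bennett,
E. Bernstein, G. Brassard, U. Vazirani, SIAM J. Comput. 26 (1997), Thm. 3.3 / Cor. 3.4; the cell record
`Cruxes/TransferPB/Lines/birth-machine-spec.md`.
-/

-- D-0017: single-conjunct summit ⇒ the duplicate `QuantumAdvantage.QuantumAdvantage` is mandated.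
set_option linter.dupNamespace false

noncomputable section

namespace Summit.QuantumAdvantage.QuantumAdvantage.Cruxes.TransferPB.Birth

open Finset Literature.Computability.Cryptography Literature.Computability.Complexity
  Literature.Computability.QuantumComplexity Literature.Computability.QuantumComplexity.ClassicalSimulation

namespace SimTreePB

variable (F : QCircuitFamily cliffordT) (x : List Bool)

/-- The oracle string named by the relevant bit `s`. -/
def bitString (s : Fin (numOracleBits F x)) : List Bool := ((bitEquiv F x).symm s).1

/-- The averaged BBBV magnitude `m_s(ρ) = E_y[4T·W_{σ(s)}(oracleOf (y ◁ ρ))]` of the relevant bit `s` after the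
path `ρ` (the quantity of the pick/refusal clauses of `stub_pbOracleSimulation_of_bbbvMachines`). -/
def bbbvMag (ρ : List (Fin (numOracleBits F x) × Bool)) (s : Fin (numOracleBits F x)) : ℝ :=
  boolAvg (fun y => 4 * ((F.circ x.length).oracleQueries : ℝ) *
    (queryWeights (oracleOf F x (ρ.foldr (fun ib z => Function.update z ib.1 ib.2) y))
      ({((bitEquiv F x).symm s).1} : Set (List Bool)) (F.circ x.length).gates
      (basisState (padInput x.get (F.ancillas x.length)))).sum)

open scoped Classical in
/-- The block magnitude `M_u(ρ) = Σ_{s : u ⊑ σ(s)} m_s(ρ)` of the prefix `u`. -/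
def blockMag (ρ : List (Fin (numOracleBits F x) × Bool)) (u : List Bool) : ℝ :=
  ∑ s ∈ univ.filter (fun s : Fin (numOracleBits F x) => u <+: bitString F x s), bbbvMag F x ρ s

/-- The mean `E[p_x|_ρ]` of the restricted acceptance polynomial. -/
def nodeMean (ρ : List (Fin (numOracleBits F x) × Bool)) : ℝ :=
  boolAvg (evalBool (restrictPath ρ (acceptPoly F x)))

variable (r : Polynomial ℕ) (c k : ℕ)

/-- The influence threshold `w = 2^{-k}(((1/10)²δ/2)/2/d)^c`, `δ = 1/(r(n)+1)`, `d = thm23Degree F x`. -/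
def pbThreshold : ℝ :=
  (1 / 2 ^ k : ℝ) * ((((1 / 10 : ℝ) ^ 2 * (1 / (((r.eval x.length : ℕ) : ℝ) + 1)) / 2) / 2) /
    thm23Degree F x) ^ c

/-- The budget `D = ⌈8T²/((w/2)δ)⌉ + 1` of the machine's walk. -/
def machineBudget : ℕ :=
  Nat.ceil (8 * ((F.circ x.length).oracleQueries : ℝ) ^ 2 /
    (pbThreshold F x r c k / 2 * (1 / (((r.eval x.length : ℕ) : ℝ) + 1)))) + 1

/-! ### Instance encodings -/

/-- Serialised path: the list of (oracle string, revealed bit) pairs, `boolPair`-nested. -/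
def encPath : List (Fin (numOracleBits F x) × Bool) → List Bool
  | [] => []
  | e :: ρ => boolPair (e.2 :: bitString F x e.1) (encPath ρ)

/-- BLOCK instance `⟨x, ρ, u⟩` (tag `00`). -/
def encBlock (ρ : List (Fin (numOracleBits F x) × Bool)) (u : List Bool) : List Bool :=
  boolPair x (boolPair (encPath F x ρ) (false :: false :: u))

/-- SINGLE instance `⟨x, ρ, s⟩` (tag `01`). -/
def encSingle (ρ : List (Fin (numOracleBits F x) × Bool)) (s : Fin (numOracleBits F x)) : List Bool :=
  boolPair x (boolPair (encPath F x ρ) (false :: true :: bitString F x s))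

/-- MEAN instance `⟨x, ρ, j⟩` (tag `1`, `j` in unary). -/
def encMean (ρ : List (Fin (numOracleBits F x) × Bool)) (j : ℕ) : List Bool :=
  boolPair x (boolPair (encPath F x ρ) (true :: List.replicate j true))

/-! ### The promise problem and the derived advisor -/

/-- **The node-test promise problem `Q_F`** (for the constants `c, k` and the error polynomial `r`): BLOCK
instances ask `M_u(ρ) ≥ w` (NO when `≤ w/2`), SINGLE instances ask `m_s(ρ) ≥ w` (NO when `≤ w/2`), MEAN
instances ask `E[p_x|_ρ] ≥ j/40` (NO when `≤ (j−1)/40`), `1 ≤ j ≤ 40`. -/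
def nodeProblem : PromiseProblem where
  yes := {v | ∃ (x : List Bool) (ρ : List (Fin (numOracleBits F x) × Bool)),
      (∃ u : List Bool, v = encBlock F x ρ u ∧ pbThreshold F x r c k ≤ blockMag F x ρ u) ∨
      (∃ s : Fin (numOracleBits F x), v = encSingle F x ρ s ∧ pbThreshold F x r c k ≤ bbbvMag F x ρ s) ∨
      (∃ j : ℕ, v = encMean F x ρ j ∧ 1 ≤ j ∧ j ≤ 40 ∧ (j : ℝ) / 40 ≤ nodeMean F x ρ)}
  no := {v | ∃ (x : List Bool) (ρ : List (Fin (numOracleBits F x) × Bool)),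
      (∃ u : List Bool, v = encBlock F x ρ u ∧ blockMag F x ρ u ≤ pbThreshold F x r c k / 2) ∨
      (∃ s : Fin (numOracleBits F x), v = encSingle F x ρ s ∧ bbbvMag F x ρ s ≤ pbThreshold F x r c k / 2) ∨
      (∃ j : ℕ, v = encMean F x ρ j ∧ 1 ≤ j ∧ j ≤ 40 ∧ nodeMean F x ρ ≤ ((j : ℝ) - 1) / 40)}

/-- The bits the descent keeps at the path `ρ` under the answers `g`: every prefix-block test of the bit's
string and its single test answered `true`. -/
def Kept (g : List Bool → Bool) (ρ : List (Fin (numOracleBits F x) × Bool)) (s : Fin (numOracleBits F x)) : Prop :=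
  (∀ j : ℕ, j ≤ (bitString F x s).length → g (encBlock F x ρ ((bitString F x s).take j)) = true) ∧
    g (encSingle F x ρ s) = true

open scoped Classical in
/-- **The advisor a machine derives from the answer function `g`**: query the least FREE kept bit (none if no
kept bit is free); at a leaf output `#{j ≤ 40 : MEAN⟨x,ρ,j⟩ answered true}/40`. -/
def derivedAdvisor (g : List Bool → Bool) : Advisor (numOracleBits F x) where
  pick ρ := if h : ∃ s : Fin (numOracleBits F x), s ∉ ρ.map Prod.fst ∧ Kept F x g ρ s then
      some (Fin.find (fun s => s ∉ ρ.map Prod.fst ∧ Kept F x g ρ s) h) else none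
  val ρ := (((Icc 1 40).filter fun j => g (encMean F x ρ j) = true).card : ℝ) / 40

end SimTreePB

end Summit.QuantumAdvantage.QuantumAdvantage.Cruxes.TransferPB.Birth

end
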